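import Literature.Probability.LatticeModels.FKIsingRSWProofs
import Literature.Probability.LatticeModels.RandomClusterConditionalDomination
import Literature.Probability.LatticeModels.RandomClusterSuccessiveConditioning
import Literature.Probability.LatticeModels.RandomClusterEmbedding
import Literature.Probability.LatticeModels.RandomClusterIsoInvariance
import Literature.Probability.LatticeModels.FKIsingAnnulusTopRect
import HarnessLib

/-!
# RSW for the critical FK-Ising model: the two-pair comparison of DCHN's second moment, proved

Topic `Literature/Probability/LatticeModels` (trunk `StatMech`, family `crit-ising`). Third
instalment (after `FKIsingRSWProofs.lean`) of the proved part of the reduction of the named fact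
`Literature.Probability.LatticeModels.fkIsing_rsw` (Duminil-Copin–Smirnov 2012, Thm. 3.16 =
Duminil-Copin–Hongler–Nolin 2011, Thm. 1 with free boundary conditions) to its two analytic
inputs, DCHN Props. 13 and 14 (fermionic observable and harmonic-measure estimates, not in the
tree). `FKIsingRSWProofs.lean` reduces `fkIsing_rsw` to the moment bounds `E⁰[N_n] ≥ c n`,
`E⁰[N_n²] ≤ C n²` and expresses `E⁰[N_n²] = Σ_{(x,u),(y,v)} φ⁰_R(x ↔ u, y ↔ v)`; here we prove
the probabilistic heart of the bound on `E⁰[N_n²]`, DCHN's display (proof of Thm. 1, Step 1,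
p. 14 of arXiv:0912.4253)

  `P⁰_{R}(x ↔ u, y ↔ v) ≤ P_{half, wired far side}(x, y ↔ wired arc) · P_{half, wired far side}(ū, v̄ ↔ wired arc)`,

"if `x` and `u` (resp. `y` and `v`) are pair-wise connected, then they are also connected to the
horizontal line which is at the middle of `R`. Moreover, the Domain Markov property implies that
the probability – in `R` with free boundary conditions – that `x` and `y` are connected to this
line is smaller than the probability of this event in the rectangle of half height with wired
boundary conditions on the top side. … Using the FKG inequality, and also the symmetry of the
lattice, we get [the display]." In H21's geometry (`fkIsing_rsw`: the `4n × n` rectangle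
`R = [0, 4n] × [0, n]`, left-to-right), the middle line is the column `{x₀ = 2n}`, the half is
`H = [0, 2n] × [0, n]` wired on its side `{x₀ = 2n}` (`halfWiredSide`), embedded in `R` once by
inclusion (`finsetIncl`, the tree's `RandomClusterDomainMarkov` API) and once by the reflection
`(x₀, x₁) ↦ (4n - x₀, x₁)` (`rswMirror`, `rswMirrorEmb`), and the result is
`real_openConnIn_inter_openConnIn_le_mul`:

  `φ⁰_R(x ↔ u ∧ y ↔ v) ≤ φ^{side}_H(x' ↔ side ∧ y' ↔ side) · φ^{side}_H(u' ↔ side ∧ v' ↔ side)`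

for `x = j_L(x')`, `y = j_L(y')`, `u = j_R(u')`, `v = j_R(v')`, all measures being the tree's
`rcMeasure (finsetGraph (zdGraph 2) ·) criticalFKIsingParam 2 ·` (= `fkIsingFiniteMeasure`,
`fkIsingFiniteMeasure_eq_finsetGraph`).

The last section then assembles the whole of DCHN's Step 1: **`fkIsing_rsw_of_connection_bounds`**
proves `fkIsing_rsw` from the two analytic inputs of that proof — DCHN Prop. 13 (`φ⁰_R(x ↔ u) ≥ c/n`
for `x`, `u` in the middle halves of the two sides) and Prop. 14 with Lemma 15
(`φ^{side}_H(a ↔ side, b ↔ side) ≤ C/√((|a₁ - b₁| + 1) n)` on the free side of the half) — taken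
as hypotheses (not named facts), via the two-pair comparison, the moment identities and the
Cauchy–Schwarz reduction of `FKIsingRSWProofs.lean`, the arithmetic
`Σ_{i,j ≤ n} 1/√((|i-j|+1) n) ≤ 12 n` and the positivity of `E⁰[N_1]`.

The proof uses only proved toolkit of the tree: conditioning on the configuration off a region and
domination of the conditional law by the wired spanning graph
(`rcMeasure_real_inter_cylinder_le_mul_fromEdgeSet`, `RandomClusterConditionalDomination`; Grimmett
2006, Lemma (4.13), (4.14)(b)), summation over cylinders (`rcMeasure_real_inter_le_mul_of_cylinder_le`,
`RandomClusterSuccessiveConditioning`), the identification of the wired spanning graph with the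
half-box measure (`rcMeasure_real_restrictConfig_preimage_of_wired`, `RandomClusterEmbedding`), the
support lemma `rcMeasure_real_mono_on_edgeSets`, packaged once as `real_inter_le_halfWired_mul`
and applied with the two embeddings; plus the deterministic decomposition of an open path at its
first and last visits to the middle column (`exists_level_reachable`,
`restrictConfig_inter_mem_halfConn`, `mem_rightConn_of_reachable`,
`restrictConfig_inter_mem_halfConn_of_mem_rightConn`). No named fact is introduced; nothing here
assumes `fkIsing_rsw`.

## Main definitions (all with bodies)

* `rswMirror n`, `rswMirrorEmb n` — the reflection of `ℤ²` exchanging the halves of `R` and the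
  induced embedding `↥H ↪ ↥R` onto the right half; `rightHalfEdges n` its edge image.
* `halfWiredSide n` — the wired side `{x₀ = 2n}` of `H`; `halfConn n a` — the increasing event
  "`a` is joined to the wired side" of `H` (`openCrossing univ {a} side`).
* `rightConn n u` — "`u` is joined to the middle column by open edges off the left half", an
  event of `R` determined off the left half.

## References

* H. Duminil-Copin, C. Hongler, P. Nolin, *Connection probabilities and RSW-type bounds for the
  two-dimensional FK Ising model*, Comm. Pure Appl. Math. 64 (2011) 1165–1198
  (arXiv:0912.4253): §4, proof of Thm. 1, Step 1; Prop. 14.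
* H. Duminil-Copin, S. Smirnov, *Conformal invariance of lattice models*, Clay Math. Proc. 15
  (2012), Thm. 3.16 and §7.2.
* G. Grimmett, *The Random-Cluster Model*, Springer (2006): Lemma (4.13), Lemma (4.14)(b),
  Thm. (3.8).
-/

noncomputable section

open MeasureTheory Finset SimpleGraph
open Literature.Probability.LatticeModels Literature.Probability.Percolation

namespace Literature.Probability.LatticeModels

/-! ### Adjacency of `ℤ²` in coordinates -/

/-- Along an edge of `ℤ²` the first coordinate changes by at most one (adjacency in coordinates
is the tree's `zdGraph_two_adj_iff_coord`; only this consequence is needed here). [folklore] -/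
theorem apply_zero_le_add_one_of_adj {x y : Site 2} (h : (zdGraph 2).Adj x y) :
    y 0 ≤ x 0 + 1 ∧ x 0 ≤ y 0 + 1 := by
  rw [zdGraph_adj_iff, Fin.exists_fin_two] at h
  simp only [funext_iff, Fin.forall_fin_two, Pi.add_apply, Pi.single_eq_same,
    Pi.single_eq_of_ne (one_ne_zero : (1 : Fin 2) ≠ 0),
    Pi.single_eq_of_ne (zero_ne_one : (0 : Fin 2) ≠ 1), add_zero] at h
  omega

/-! ### The `4n × n` rectangle, its left half `2n × n`, and the two embeddings of the half -/

section Geometry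

variable (n : ℕ)

/-- The left half `[0, 2n] × [0, n]` of the rectangle `[0, 4n] × [0, n]`. [folklore] -/
theorem rectangle_half_subset : rectangle (2 * n) n ⊆ rectangle (4 * n) n := by
  intro x hx
  rw [mem_rectangle_iff] at hx ⊢
  push_cast at hx ⊢
  omega

/-- The reflection `(x₀, x₁) ↦ (4n - x₀, x₁)` of `ℤ²` in the vertical axis of the rectangle
`[0, 4n] × [0, n]` (the lattice symmetry exchanging its two halves; DCHN 2011, proof of Thm. 1,
Step 1, "using also the symmetry of the lattice"). [folklore] -/
def rswMirror (x : Site 2) : Site 2 := ![(4 * n : ℤ) - x 0, x 1]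

/-- First coordinate of the reflection. [folklore] -/
@[simp] theorem rswMirror_apply_zero (x : Site 2) : rswMirror n x 0 = 4 * n - x 0 := rfl

/-- Second coordinate of the reflection. [folklore] -/
@[simp] theorem rswMirror_apply_one (x : Site 2) : rswMirror n x 1 = x 1 := rfl

/-- The reflection is an involution. [folklore] -/
theorem rswMirror_rswMirror (x : Site 2) : rswMirror n (rswMirror n x) = x := by
  ext i
  fin_cases i
  · simp
  · simp

/-- The reflection is injective. [folklore] -/
theorem rswMirror_injective : Function.Injective (rswMirror n) :=
  Function.Involutive.injective (rswMirror_rswMirror n)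

/-- The reflection maps the left half into the rectangle (onto its right half). [folklore] -/
theorem rswMirror_mem_rectangle {x : Site 2} (hx : x ∈ rectangle (2 * n) n) :
    rswMirror n x ∈ rectangle (4 * n) n := by
  rw [mem_rectangle_iff] at hx ⊢
  simp only [rswMirror_apply_zero, rswMirror_apply_one]
  push_cast at hx ⊢
  omega

/-- The reflection is a lattice symmetry: it preserves and reflects adjacency. [folklore] -/
theorem adj_rswMirror_iff (x y : Site 2) :
    (zdGraph 2).Adj (rswMirror n x) (rswMirror n y) ↔ (zdGraph 2).Adj x y := by
  rw [zdGraph_adj_iff, zdGraph_adj_iff, Fin.exists_fin_two, Fin.exists_fin_two]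
  simp only [funext_iff, Fin.forall_fin_two, Pi.add_apply, Pi.single_eq_same,
    Pi.single_eq_of_ne (one_ne_zero : (1 : Fin 2) ≠ 0),
    Pi.single_eq_of_ne (zero_ne_one : (0 : Fin 2) ≠ 1), add_zero, rswMirror_apply_zero,
    rswMirror_apply_one]
  omega

/-- The embedding of the half `[0, 2n] × [0, n]` onto the right half `[2n, 4n] × [0, n]` of the
rectangle by the reflection `rswMirror`; its wired side `{x₀ = 2n}` goes to the middle column.
[folklore] -/
def rswMirrorEmb : ↥(rectangle (2 * n) n) ↪ ↥(rectangle (4 * n) n) :=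
  ⟨fun a ↦ ⟨rswMirror n a.1, rswMirror_mem_rectangle n a.2⟩,
    fun _ _ h ↦ Subtype.ext (rswMirror_injective n (congrArg Subtype.val h))⟩

/-- The underlying site of the mirrored embedding. [folklore] -/
@[simp] theorem rswMirrorEmb_coe (a : ↥(rectangle (2 * n) n)) :
    (rswMirrorEmb n a : Site 2) = rswMirror n a.1 := rfl

/-- The mirrored embedding preserves and reflects adjacency of the rectangle graphs. [folklore] -/
theorem adj_rswMirrorEmb_iff (a b : ↥(rectangle (2 * n) n)) :
    (finsetGraph (zdGraph 2) (rectangle (4 * n) n)).Adj (rswMirrorEmb n a) (rswMirrorEmb n b) ↔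
      (finsetGraph (zdGraph 2) (rectangle (2 * n) n)).Adj a b := by
  rw [finsetGraph_adj_iff, finsetGraph_adj_iff, rswMirrorEmb_coe, rswMirrorEmb_coe, adj_rswMirror_iff]

/-- The edges of the right half: images of the edges of the half under the mirrored embedding
(the region `U` of the second conditioning). [folklore] -/
def rightHalfEdges : Finset (Sym2 ↥(rectangle (4 * n) n)) :=
  (finsetGraph (zdGraph 2) (rectangle (2 * n) n)).edgeFinset.map (rswMirrorEmb n).sym2Map

/-- Right-half edges are edges of the rectangle. [folklore] -/
theorem rightHalfEdges_subset_edgeFinset :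
    rightHalfEdges n ⊆ (finsetGraph (zdGraph 2) (rectangle (4 * n) n)).edgeFinset := by
  intro e he
  obtain ⟨e', he', rfl⟩ := Finset.mem_map.1 he
  induction e' using Sym2.ind with
  | h a b =>
    rw [mem_edgeFinset, mem_edgeSet] at he'
    rw [Function.Embedding.sym2Map_apply, Sym2.map_mk, mem_edgeFinset, mem_edgeSet]
    exact (adj_rswMirrorEmb_iff n a b).2 he'

/-- A pair of adjacent vertices of the rectangle both in the right half `{x₀ ≥ 2n}` spans a
right-half edge. [folklore] -/
theorem mk_mem_rightHalfEdges {a b : ↥(rectangle (4 * n) n)}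
    (hab : (finsetGraph (zdGraph 2) (rectangle (4 * n) n)).Adj a b)
    (ha : (2 * n : ℤ) ≤ a.1 0) (hb : (2 * n : ℤ) ≤ b.1 0) : s(a, b) ∈ rightHalfEdges n := by
  have haR := mem_rectangle_iff.1 a.2
  have hbR := mem_rectangle_iff.1 b.2
  have ha' : rswMirror n a.1 ∈ rectangle (2 * n) n := by
    rw [mem_rectangle_iff]; simp only [rswMirror_apply_zero, rswMirror_apply_one]
    push_cast at haR ⊢; omega
  have hb' : rswMirror n b.1 ∈ rectangle (2 * n) n := by
    rw [mem_rectangle_iff]; simp only [rswMirror_apply_zero, rswMirror_apply_one]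
    push_cast at hbR ⊢; omega
  rw [rightHalfEdges, Finset.mem_map]
  refine ⟨s(⟨rswMirror n a.1, ha'⟩, ⟨rswMirror n b.1, hb'⟩), ?_, ?_⟩
  · rw [mem_edgeFinset, mem_edgeSet, finsetGraph_adj_iff]
    change (zdGraph 2).Adj (rswMirror n a.1) (rswMirror n b.1)
    rw [adj_rswMirror_iff]
    exact hab
  · rw [Function.Embedding.sym2Map_apply, Sym2.map_mk]
    congr 1 <;> exact Subtype.ext (rswMirror_rswMirror n _)

/-- A pair of adjacent vertices of the rectangle both in the left half `{x₀ ≤ 2n}` spans an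
inside edge of the left half. [folklore] -/
theorem mk_mem_insideEdges_half {a b : ↥(rectangle (4 * n) n)}
    (hab : (finsetGraph (zdGraph 2) (rectangle (4 * n) n)).Adj a b)
    (ha : a.1 0 ≤ (2 * n : ℤ)) (hb : b.1 0 ≤ (2 * n : ℤ)) :
    s(a, b) ∈ insideEdges (zdGraph 2) (rectangle_half_subset n) := by
  have haR := mem_rectangle_iff.1 a.2
  have hbR := mem_rectangle_iff.1 b.2
  have ha' : a.1 ∈ rectangle (2 * n) n := by rw [mem_rectangle_iff]; push_cast at haR ⊢; omega
  have hb' : b.1 ∈ rectangle (2 * n) n := by rw [mem_rectangle_iff]; push_cast at hbR ⊢; omega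
  have heq : s(a, b) = edgeLift (rectangle_half_subset n) s(⟨a.1, ha'⟩, ⟨b.1, hb'⟩) := by
    rw [edgeLift_mk]; rfl
  rw [heq, edgeLift_mem_insideEdges_iff, mem_edgeFinset, mem_edgeSet, finsetGraph_adj_iff]
  exact hab

end Geometry

/-! ### The wired side of the half and the two wired sets of the rectangle -/

section Wired

variable (n : ℕ)

/-- The wired side `{x₀ = 2n}` of the half `[0, 2n] × [0, n]` (the middle column of the
rectangle, wired in DCHN's half-height rectangle `R_m^{2β}` with Dobrushin points at its far
corners; DCHN 2011, proof of Thm. 1, Step 1). [folklore] -/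
def halfWiredSide : Set ↥(rectangle (2 * n) n) := {a | a.1 0 = 2 * n}

/-- Membership in the wired side. [folklore] -/
@[simp] theorem mem_halfWiredSide {a : ↥(rectangle (2 * n) n)} :
    a ∈ halfWiredSide n ↔ a.1 0 = 2 * n := Iff.rfl

/-- The wired side is nonempty (it contains `(2n, 0)`). [folklore] -/
theorem halfWiredSide_nonempty : (halfWiredSide n).Nonempty := by
  refine ⟨⟨![(2 * n : ℤ), 0], ?_⟩, ?_⟩
  · rw [mem_rectangle_iff]
    simp
  · simp [halfWiredSide]

/-- The range of the left embedding `finsetIncl` of the half is `{x₀ ≤ 2n}`. [folklore] -/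
theorem exists_finsetIncl_eq_iff (u : ↥(rectangle (4 * n) n)) :
    (∃ x : ↥(rectangle (2 * n) n), finsetIncl (rectangle_half_subset n) x = u) ↔
      u.1 0 ≤ 2 * n := by
  constructor
  · rintro ⟨x, rfl⟩
    have := mem_rectangle_iff.1 x.2
    rw [finsetIncl_coe]
    push_cast at this
    exact this.2.1
  · intro hu
    have huR := mem_rectangle_iff.1 u.2
    refine ⟨⟨u.1, ?_⟩, Subtype.ext rfl⟩
    rw [mem_rectangle_iff]
    push_cast at huR ⊢
    omega

/-- The range of the mirrored embedding of the half is `{x₀ ≥ 2n}`. [folklore] -/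
theorem exists_rswMirrorEmb_eq_iff (u : ↥(rectangle (4 * n) n)) :
    (∃ x : ↥(rectangle (2 * n) n), rswMirrorEmb n x = u) ↔ (2 * n : ℤ) ≤ u.1 0 := by
  constructor
  · rintro ⟨x, rfl⟩
    have := mem_rectangle_iff.1 x.2
    rw [rswMirrorEmb_coe, rswMirror_apply_zero]
    push_cast at this
    omega
  · intro hu
    have huR := mem_rectangle_iff.1 u.2
    refine ⟨⟨rswMirror n u.1, ?_⟩, Subtype.ext (rswMirror_rswMirror n u.1)⟩
    rw [mem_rectangle_iff]
    simp only [rswMirror_apply_zero, rswMirror_apply_one]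
    push_cast at huR ⊢
    omega

/-- The wired set of the first conditioning: the right half `{x₀ ≥ 2n}` is the wired side of
the embedded left half together with the idle vertices. [folklore] -/
theorem mem_setOf_le_iff_finsetIncl (u : ↥(rectangle (4 * n) n)) :
    u ∈ {w : ↥(rectangle (4 * n) n) | (2 * n : ℤ) ≤ w.1 0} ↔
      ∀ x : ↥(rectangle (2 * n) n), finsetIncl (rectangle_half_subset n) x = u →
        x ∈ halfWiredSide n := by
  rw [Set.mem_setOf_eq]
  constructor
  · rintro hu x rfl
    have := mem_rectangle_iff.1 x.2
    rw [finsetIncl_coe] at hu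
    rw [mem_halfWiredSide]
    push_cast at this
    omega
  · intro h
    by_contra hu
    push Not at hu
    obtain ⟨x, hx⟩ := (exists_finsetIncl_eq_iff n u).2 hu.le
    have h1 := h x hx
    rw [mem_halfWiredSide] at h1
    rw [← hx, finsetIncl_coe] at hu
    omega

/-- The wired set of the second conditioning: the left half `{x₀ ≤ 2n}` is the wired side of
the mirrored half together with the idle vertices. [folklore] -/
theorem mem_setOf_ge_iff_rswMirrorEmb (u : ↥(rectangle (4 * n) n)) :
    u ∈ {w : ↥(rectangle (4 * n) n) | w.1 0 ≤ 2 * n} ↔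
      ∀ x : ↥(rectangle (2 * n) n), rswMirrorEmb n x = u → x ∈ halfWiredSide n := by
  rw [Set.mem_setOf_eq]
  constructor
  · rintro hu x rfl
    have := mem_rectangle_iff.1 x.2
    rw [rswMirrorEmb_coe, rswMirror_apply_zero] at hu
    rw [mem_halfWiredSide]
    push_cast at this
    omega
  · intro h
    by_contra hu
    push Not at hu
    obtain ⟨x, hx⟩ := (exists_rswMirrorEmb_eq_iff n u).2 hu.le
    have h1 := h x hx
    rw [mem_halfWiredSide] at h1
    rw [← hx, rswMirrorEmb_coe, rswMirror_apply_zero] at hu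
    omega

/-- Edges of the rectangle off the left half have both endpoints in `{x₀ ≥ 2n}`. [folklore] -/
theorem mem_setOf_le_of_mem_sdiff_insideEdges :
    ∀ e ∈ (finsetGraph (zdGraph 2) (rectangle (4 * n) n)).edgeFinset \
        insideEdges (zdGraph 2) (rectangle_half_subset n),
      ∀ x ∈ e, x ∈ {w : ↥(rectangle (4 * n) n) | (2 * n : ℤ) ≤ w.1 0} := by
  intro e he
  rw [Finset.mem_sdiff] at he
  obtain ⟨heE, heU⟩ := he
  induction e using Sym2.ind with
  | h a b =>
    rw [mem_edgeFinset, mem_edgeSet] at heE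
    have hlip := apply_zero_le_add_one_of_adj ((finsetGraph_adj_iff a b).1 heE)
    have hnot : ¬(a.1 0 ≤ 2 * n ∧ b.1 0 ≤ 2 * n) := fun h ↦
      heU (mk_mem_insideEdges_half n heE h.1 h.2)
    intro x hx
    rw [Set.mem_setOf_eq]
    rcases Sym2.mem_iff.1 hx with rfl | rfl <;> omega

/-- Edges of the rectangle off the right half have both endpoints in `{x₀ ≤ 2n}`. [folklore] -/
theorem mem_setOf_ge_of_mem_sdiff_rightHalfEdges :
    ∀ e ∈ (finsetGraph (zdGraph 2) (rectangle (4 * n) n)).edgeFinset \ rightHalfEdges n,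
      ∀ x ∈ e, x ∈ {w : ↥(rectangle (4 * n) n) | w.1 0 ≤ 2 * n} := by
  intro e he
  rw [Finset.mem_sdiff] at he
  obtain ⟨heE, heU⟩ := he
  induction e using Sym2.ind with
  | h a b =>
    rw [mem_edgeFinset, mem_edgeSet] at heE
    have hlip := apply_zero_le_add_one_of_adj ((finsetGraph_adj_iff a b).1 heE)
    have hnot : ¬((2 * n : ℤ) ≤ a.1 0 ∧ (2 * n : ℤ) ≤ b.1 0) := fun h ↦
      heU (mk_mem_rightHalfEdges n heE h.1 h.2)
    intro x hx
    rw [Set.mem_setOf_eq]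
    rcases Sym2.mem_iff.1 hx with rfl | rfl <;> omega

/-- The edges off the left half are right-half edges. [folklore] -/
theorem outsideEdges_subset_rightHalfEdges :
    outsideEdges (zdGraph 2) (rectangle_half_subset n) ⊆ rightHalfEdges n := by
  intro e he
  have he' := he
  rw [outsideEdges, Finset.mem_sdiff] at he'
  induction e using Sym2.ind with
  | h a b =>
    have hends := mem_setOf_le_of_mem_sdiff_insideEdges n _ he
    rw [mem_edgeFinset, mem_edgeSet] at he'
    exact mk_mem_rightHalfEdges n he'.1 (hends a (Sym2.mem_mk_left a b))
      (hends b (Sym2.mem_mk_right a b))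

end Wired

/-! ### One conditioning: free measure of the rectangle versus the half wired on its far side -/

section Conditioning

variable {n : ℕ}

/-- **One domain Markov comparison** (DCHN 2011, proof of Thm. 1, Step 1: "the Domain Markov
property implies that the probability – in `R` with free boundary conditions – that `x` and `y`
are connected to this line is smaller than the probability of this event in the rectangle of half
height with wired boundary conditions on the top side"; Grimmett 2006, Lemma (4.13) and
Lemma (4.14)(b)). Let `j` embed the half `[0, 2n] × [0, n]` into the rectangle `[0, 4n] × [0, n]`
as a union `U` of edges, in such a way that every edge off `U` has its endpoints in the set `W` of
vertices that are either idle or images of the wired side `{x₀ = 2n}`. Then for an increasing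
event `A` of the half and an event `F` of the rectangle determined off `U`,
`φ⁰_R(j^*(ω ∩ U) ∈ A, ω ∈ F) ≤ φ^{side}_{half}(A) · φ⁰_R(F)`: condition on the configuration `ξ`
off `U` (`rcMeasure_real_inter_le_mul_of_cylinder_le`), dominate the conditional law by the
spanning graph `⟨U⟩` wired on `W` (`rcMeasure_real_inter_cylinder_le_mul_fromEdgeSet`), and
identify the latter with the half wired on its side (`rcMeasure_real_restrictConfig_preimage_of_wired`).
[cite: DuminilCopinHonglerNolin2011, §4, proof of Thm. 1, Step 1; Grimmett2006, Lemma (4.14)(b)] -/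
theorem real_inter_le_halfWired_mul (j : ↥(rectangle (2 * n) n) ↪ ↥(rectangle (4 * n) n))
    {U : Finset (Sym2 ↥(rectangle (4 * n) n))}
    (hUdef : U = (finsetGraph (zdGraph 2) (rectangle (2 * n) n)).edgeFinset.map j.sym2Map)
    (hU : U ⊆ (finsetGraph (zdGraph 2) (rectangle (4 * n) n)).edgeFinset)
    {W : Set ↥(rectangle (4 * n) n)} (hW : ∀ u, u ∈ W ↔ ∀ x, j x = u → x ∈ halfWiredSide n)
    (hoff : ∀ e ∈ (finsetGraph (zdGraph 2) (rectangle (4 * n) n)).edgeFinset \ U, ∀ x ∈ e, x ∈ W)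
    {A : Set (BondConfig ↥(rectangle (2 * n) n))} (hA : IsUpperSet A)
    {F : Set (BondConfig ↥(rectangle (4 * n) n))}
    (hF : ∀ ω₁ ω₂ : BondConfig ↥(rectangle (4 * n) n),
      ω₁ ∩ (↑U)ᶜ = ω₂ ∩ (↑U)ᶜ → (ω₁ ∈ F ↔ ω₂ ∈ F)) :
    (rcMeasure (finsetGraph (zdGraph 2) (rectangle (4 * n) n)) criticalFKIsingParam 2 ∅).real
        ({ω | restrictConfig j (ω ∩ ↑U) ∈ A} ∩ F) ≤
      (rcMeasure (finsetGraph (zdGraph 2) (rectangle (2 * n) n)) criticalFKIsingParam 2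
          (halfWiredSide n)).real A *
        (rcMeasure (finsetGraph (zdGraph 2) (rectangle (4 * n) n)) criticalFKIsingParam 2 ∅).real
          F := by
  have hp : criticalFKIsingParam ∈ Set.Icc (0 : ℝ) 1 := criticalFKIsingParam_mem_Icc
  set A' : Set (BondConfig ↥(rectangle (4 * n) n)) := restrictConfig j ⁻¹' A with hA'
  have hA'up : IsUpperSet A' := fun ω₁ ω₂ h hω₁ ↦ hA (fun e he ↦ h he) hω₁
  have hX : {ω : BondConfig ↥(rectangle (4 * n) n) | restrictConfig j (ω ∩ ↑U) ∈ A} =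
      {ω | ω ∩ ↑U ∈ A'} := rfl
  -- the edge set of `⟨U⟩` is `U`, for every `Fintype` instance (the instance of the embedding
  -- lemma differs from the one synthesised for `fromEdgeSet`)
  have hE' : ∀ i : Fintype (fromEdgeSet (U : Set (Sym2 ↥(rectangle (4 * n) n)))).edgeSet,
      @SimpleGraph.edgeFinset _ (fromEdgeSet (U : Set (Sym2 ↥(rectangle (4 * n) n)))) i =
        (finsetGraph (zdGraph 2) (rectangle (2 * n) n)).edgeFinset.map j.sym2Map := fun i ↦ by
    rw [@edgeFinset_fromEdgeSet_of_subset _ _ (finsetGraph (zdGraph 2) (rectangle (4 * n) n)) _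
      U hU i, hUdef]
  have hident := rcMeasure_real_restrictConfig_preimage_of_wired j (hE' _) hp two_pos
    (halfWiredSide_nonempty n) hW A
  rw [hX]
  refine rcMeasure_real_inter_le_mul_of_cylinder_le _ hp two_pos ∅ U hF fun ξ hξ ↦ ?_
  have hξW : ∀ e ∈ (↑ξ : Set (Sym2 ↥(rectangle (4 * n) n))), ∀ x ∈ e, x ∈ W :=
    fun e he x hx ↦ hoff e (hξ he) x hx
  have key := rcMeasure_real_inter_cylinder_le_mul_fromEdgeSet _ hp one_le_two ∅ U hU
    (↑ξ) (Set.empty_subset W) hξW hA'up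
  rw [hident] at key
  linarith [key]

end Conditioning

/-! ### Open paths and the middle column: first and last visits -/

section Walks

variable {W : Type*} {K : SimpleGraph W}

/-- **First visit to a level.** If a coordinate `g` increases by at most one along every edge of
`K`, a `K`-walk from a vertex with `g ≤ m` to a vertex with `g ≥ m` reaches a vertex `z` with
`g z = m` through edges each having an endpoint strictly below level `m` (the part of the walk
before its first visit to level `m`; DCHN 2011, proof of Thm. 1, Step 1: "if `x` and `u` are
connected, then they are also connected to the horizontal line which is at the middle").
[folklore] -/
theorem exists_level_reachable (g : W → ℤ) (m : ℤ)
    (hstep : ∀ ⦃a b : W⦄, K.Adj a b → g b ≤ g a + 1) {x u : W} (p : K.Walk x u)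
    (hx : g x ≤ m) (hu : m ≤ g u) :
    ∃ z, g z = m ∧ (K ⊓ fromRel fun a _ ↦ g a < m).Reachable x z := by
  induction p with
  | nil => exact ⟨_, le_antisymm hx hu, Reachable.refl _⟩
  | @cons a b c hab p ih =>
    by_cases ha : g a = m
    · exact ⟨a, ha, Reachable.refl _⟩
    · have ha' : g a < m := lt_of_le_of_ne hx ha
      have hb : g b ≤ m := by have := hstep hab; omega
      obtain ⟨z, hz, hreach⟩ := ih hb hu
      refine ⟨z, hz, (Adj.reachable ?_).trans hreach⟩
      rw [inf_adj, fromRel_adj]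
      exact ⟨hab, hab.ne, Or.inl ha'⟩

/-- A function that takes equal values at adjacent vertices takes equal values at the ends of a
walk; here in the form: `K`-adjacent vertices are `K'`-reachable after a partial map, hence so
are the ends of a `K`-walk. [folklore] -/
theorem exists_reachable_of_walk {W₁ : Type*} {K' : SimpleGraph W₁} (ι : W₁ → W)
    (hadj : ∀ ⦃a b : W⦄, K.Adj a b → ∀ a', ι a' = a → ∃ b', ι b' = b ∧ K'.Adj a' b')
    {a z : W} (p : K.Walk a z) :
    ∀ a', ι a' = a → ∃ z', ι z' = z ∧ K'.Reachable a' z' := by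
  induction p with
  | nil => exact fun a' ha' ↦ ⟨a', ha', Reachable.refl _⟩
  | @cons a b c hab p ih =>
    intro a' ha'
    obtain ⟨b', hb', hadj'⟩ := hadj hab a' ha'
    obtain ⟨z', hz', hreach⟩ := ih b' hb'
    exact ⟨z', hz', hadj'.reachable.trans hreach⟩

end Walks

section Pullback

variable {V₁ V : Type*} (ι : V₁ ↪ V)

/-- **Pulling an open path back to a sub-box.** Let `ι` embed `V₁` onto the sub-level set
`{f ≤ m}` of a coordinate `f` that increases by at most one along the open edges. An open path
all of whose edges have an endpoint strictly below level `m` stays in `ι(V₁)` and pulls back to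
an open path of the restricted configuration `ι^*ω`. [folklore] -/
theorem exists_reachable_restrictConfig_of_reachable_below (f : V → ℤ) (m : ℤ)
    (hrange : ∀ v, (∃ a, ι a = v) ↔ f v ≤ m) {ω : Set (Sym2 V)}
    (hlip : ∀ ⦃a b : V⦄, (Percolation.openGraph ω).Adj a b → f b ≤ f a + 1)
    {x' : V₁} {z : V}
    (h : (Percolation.openGraph ω ⊓ fromRel fun a _ ↦ f a < m).Reachable (ι x') z) :
    ∃ z', ι z' = z ∧ (Percolation.openGraph (restrictConfig ι ω)).Reachable x' z' := by
  obtain ⟨p⟩ := h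
  refine exists_reachable_of_walk ι ?_ p x' rfl
  intro a b hab a' ha'
  rw [inf_adj, fromRel_adj, Percolation.openGraph_adj] at hab
  obtain ⟨⟨hmem, hne⟩, -, hlt⟩ := hab
  have hfa : f a ≤ m := (hrange a).1 ⟨a', ha'⟩
  have hfb : f b ≤ m := by
    rcases hlt with h | h
    · have := hlip ((Percolation.openGraph_adj ω a b).2 ⟨hmem, hne⟩); omega
    · exact h.le
  obtain ⟨b', rfl⟩ := (hrange b).2 hfb
  subst ha'
  refine ⟨b', rfl, ?_⟩
  rw [Percolation.openGraph_adj, Percolation.mem_restrictConfig, Sym2.map_mk]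
  exact ⟨hmem, fun h ↦ hne (congrArg ι h)⟩

/-- **Pulling back an open path of inside edges**: if every edge of `F` has both endpoints in
`ι(V₁)`, an `(ω ∩ F)`-open path between points of `ι(V₁)` pulls back to an open path of `ι^*ω`.
[folklore] -/
theorem reachable_restrictConfig_of_reachable_inter {F : Set (Sym2 V)}
    (hF : ∀ e ∈ F, ∀ v ∈ e, ∃ a, ι a = v) {ω : Set (Sym2 V)} {a' b' : V₁}
    (h : (fromEdgeSet (ω ∩ F)).Reachable (ι a') (ι b')) :
    (Percolation.openGraph (restrictConfig ι ω)).Reachable a' b' := by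
  obtain ⟨p⟩ := h
  have hadj : ∀ ⦃a b : V⦄, (fromEdgeSet (ω ∩ F)).Adj a b → ∀ a₁, ι a₁ = a →
      ∃ b₁, ι b₁ = b ∧ (Percolation.openGraph (restrictConfig ι ω)).Adj a₁ b₁ := by
    intro a b hab a₁ ha₁
    rw [fromEdgeSet_adj] at hab
    obtain ⟨⟨hmem, hmemF⟩, hne⟩ := hab
    obtain ⟨b₁, rfl⟩ := hF _ hmemF b (Sym2.mem_mk_right a b)
    subst ha₁
    refine ⟨b₁, rfl, ?_⟩
    rw [Percolation.openGraph_adj, Percolation.mem_restrictConfig, Sym2.map_mk]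
    exact ⟨hmem, fun h ↦ hne (congrArg ι h)⟩
  obtain ⟨b'', hb'', hreach⟩ := exists_reachable_of_walk ι hadj p a' rfl
  obtain rfl := ι.injective hb''
  exact hreach

end Pullback

/-! ### The events: connection to the wired side in the half, and to the middle column from the right -/

section Events

variable (n : ℕ)

/-- The event of the half `[0, 2n] × [0, n]` that `a` is joined by an open path to the wired side
`{x₀ = 2n}` (`a ↔ wired arc` in DCHN's half-height rectangle; DCHN 2011, Prop. 14 and proof of
Thm. 1, Step 1). [cite: DuminilCopinHonglerNolin2011, §4, Prop. 14] -/
def halfConn (a : ↥(rectangle (2 * n) n)) : Set (BondConfig ↥(rectangle (2 * n) n)) :=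
  openCrossing Set.univ {a} (halfWiredSide n)

/-- `halfConn` is increasing. [folklore] -/
theorem isUpperSet_halfConn (a : ↥(rectangle (2 * n) n)) : IsUpperSet (halfConn n a) :=
  isUpperSet_openCrossing _ _ _

/-- Connection inside the whole vertex set is plain reachability in the open graph. [folklore] -/
theorem mem_openConnIn_univ_iff {X : Type*} {ω : BondConfig X} {x y : X} :
    ω ∈ openConnIn Set.univ x y ↔ (openGraph ω).Reachable x y := by
  constructor
  · rintro ⟨hx, hy, h⟩
    have := (Iso.reachable_iff (φ := induceUnivIso (openGraph ω))).2 h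
    simpa using this
  · intro h
    refine ⟨Set.mem_univ x, Set.mem_univ y, ?_⟩
    rw [← Iso.reachable_iff (φ := induceUnivIso (openGraph ω))]
    simpa using h

/-- Membership in `halfConn`: some vertex of the wired side is reachable in the open graph.
[folklore] -/
theorem mem_halfConn_iff {a : ↥(rectangle (2 * n) n)} {ω : BondConfig ↥(rectangle (2 * n) n)} :
    ω ∈ halfConn n a ↔ ∃ z ∈ halfWiredSide n, (openGraph ω).Reachable a z := by
  simp only [halfConn, mem_openCrossing_iff, Set.mem_singleton_iff, exists_eq_left,
    mem_openConnIn_univ_iff]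

/-- The event of the rectangle that `u` is joined to the middle column `{x₀ = 2n}` by a path of
open edges off the left half (edges with an endpoint in `{x₀ > 2n}`): it depends only on the
configuration off the left half. (DCHN 2011, proof of Thm. 1, Step 1: `u` and `v` "are also
connected to the horizontal line".) [folklore] -/
def rightConn (u : ↥(rectangle (4 * n) n)) : Set (BondConfig ↥(rectangle (4 * n) n)) :=
  {ω | ∃ z : ↥(rectangle (4 * n) n), z.1 0 = 2 * n ∧
    (fromEdgeSet (ω ∩ ↑(outsideEdges (zdGraph 2) (rectangle_half_subset n)))).Reachable u z}

/-- `rightConn` is determined by the configuration off the left half. [folklore] -/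
theorem rightConn_determined (u : ↥(rectangle (4 * n) n))
    (ω₁ ω₂ : BondConfig ↥(rectangle (4 * n) n))
    (h : ω₁ ∩ (↑(insideEdges (zdGraph 2) (rectangle_half_subset n)))ᶜ =
      ω₂ ∩ (↑(insideEdges (zdGraph 2) (rectangle_half_subset n)))ᶜ) :
    ω₁ ∈ rightConn n u ↔ ω₂ ∈ rightConn n u := by
  have hsub : (↑(outsideEdges (zdGraph 2) (rectangle_half_subset n)) :
      Set (Sym2 ↥(rectangle (4 * n) n))) ⊆
      (↑(insideEdges (zdGraph 2) (rectangle_half_subset n)))ᶜ := by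
    intro e he heU
    exact Finset.disjoint_left.1 (disjoint_insideEdges_outsideEdges (rectangle_half_subset n))
      (Finset.mem_coe.1 heU) (Finset.mem_coe.1 he)
  have heq : ω₁ ∩ ↑(outsideEdges (zdGraph 2) (rectangle_half_subset n)) =
      ω₂ ∩ ↑(outsideEdges (zdGraph 2) (rectangle_half_subset n)) := by
    have h1 : ω₁ ∩ ↑(outsideEdges (zdGraph 2) (rectangle_half_subset n)) =
        (ω₁ ∩ (↑(insideEdges (zdGraph 2) (rectangle_half_subset n)))ᶜ) ∩
          ↑(outsideEdges (zdGraph 2) (rectangle_half_subset n)) := by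
      rw [Set.inter_assoc, Set.inter_eq_right.2 hsub]
    have h2 : ω₂ ∩ ↑(outsideEdges (zdGraph 2) (rectangle_half_subset n)) =
        (ω₂ ∩ (↑(insideEdges (zdGraph 2) (rectangle_half_subset n)))ᶜ) ∩
          ↑(outsideEdges (zdGraph 2) (rectangle_half_subset n)) := by
      rw [Set.inter_assoc, Set.inter_eq_right.2 hsub]
    rw [h1, h2, h]
  simp only [rightConn, Set.mem_setOf_eq, heq]

/-- Endpoints of inside edges of the left half lie in `{x₀ ≤ 2n}`. [folklore] -/
theorem apply_zero_le_of_mem_insideEdges {e : Sym2 ↥(rectangle (4 * n) n)}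
    (he : e ∈ insideEdges (zdGraph 2) (rectangle_half_subset n)) :
    ∀ v ∈ e, v.1 0 ≤ 2 * n := by
  obtain ⟨e', -, rfl⟩ := Finset.mem_map.1 he
  induction e' using Sym2.ind with
  | h a b =>
    intro v hv
    change v ∈ Sym2.map (finsetIncl (rectangle_half_subset n)) s(a, b) at hv
    rw [Sym2.map_mk, Sym2.mem_iff] at hv
    have ha := mem_rectangle_iff.1 a.2
    have hb := mem_rectangle_iff.1 b.2
    push_cast at ha hb
    rcases hv with rfl | rfl
    · rw [finsetIncl_coe]; exact ha.2.1
    · rw [finsetIncl_coe]; exact hb.2.1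

variable {n}

/-- **First visit to the middle column, pulled back to the left half.** For a lattice
configuration `ω` of the rectangle and an open path from `x` (`x₀ ≤ 2n`, `x = j_L(x')`) to `u`
(`u₀ ≥ 2n`), the restriction to the left half of `ω ∩ (E of the left half)` joins `x'` to the
wired side. [folklore] -/
theorem restrictConfig_inter_mem_halfConn {ω : BondConfig ↥(rectangle (4 * n) n)}
    (hω : ω ⊆ (finsetGraph (zdGraph 2) (rectangle (4 * n) n)).edgeSet)
    {x u : ↥(rectangle (4 * n) n)} {x' : ↥(rectangle (2 * n) n)}
    (hx : finsetIncl (rectangle_half_subset n) x' = x) (hu : (2 * n : ℤ) ≤ u.1 0)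
    (h : (openGraph ω).Reachable x u) :
    restrictConfig (finsetInclEmb (rectangle_half_subset n))
        (ω ∩ ↑(insideEdges (zdGraph 2) (rectangle_half_subset n))) ∈ halfConn n x' := by
  set U : Finset (Sym2 ↥(rectangle (4 * n) n)) := insideEdges (zdGraph 2) (rectangle_half_subset n)
  have hlipω : ∀ ⦃a b : ↥(rectangle (4 * n) n)⦄, (openGraph ω).Adj a b → b.1 0 ≤ a.1 0 + 1 :=
    fun a b hab ↦ (apply_zero_le_add_one_of_adj ((finsetGraph_adj_iff a b).1
      ((mem_edgeSet (G := finsetGraph (zdGraph 2) (rectangle (4 * n) n))).1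
        (hω ((openGraph_adj ω a b).1 hab).1)))).1
  have hx0 : x.1 0 ≤ 2 * n := by
    rw [← hx, finsetIncl_coe]
    have := mem_rectangle_iff.1 x'.2
    push_cast at this
    exact this.2.1
  obtain ⟨p⟩ := h
  obtain ⟨z, hz, hreach⟩ := exists_level_reachable (fun a : ↥(rectangle (4 * n) n) ↦ a.1 0)
    (2 * n) hlipω p hx0 hu
  -- the same path is open in `ω ∩ U`
  have hmono : (openGraph ω ⊓ fromRel fun a _ ↦ a.1 0 < 2 * n) ≤
      (openGraph (ω ∩ ↑U) ⊓ fromRel fun a _ ↦ a.1 0 < 2 * n) := by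
    intro a b hab
    rw [inf_adj, fromRel_adj, openGraph_adj] at hab ⊢
    obtain ⟨⟨hmem, hne⟩, -, hlt⟩ := hab
    have hadj : (finsetGraph (zdGraph 2) (rectangle (4 * n) n)).Adj a b :=
      (mem_edgeSet (G := finsetGraph (zdGraph 2) (rectangle (4 * n) n))).1 (hω hmem)
    have hlip := apply_zero_le_add_one_of_adj ((finsetGraph_adj_iff a b).1 hadj)
    have hab2 : a.1 0 ≤ 2 * n ∧ b.1 0 ≤ 2 * n := by
      rcases hlt with hlt | hlt <;> constructor <;> omega
    refine ⟨⟨⟨hmem, Finset.mem_coe.2 (mk_mem_insideEdges_half n hadj hab2.1 hab2.2)⟩, hne⟩,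
      hne, hlt⟩
  have hreach' := hreach.mono hmono
  have hlip' : ∀ ⦃a b : ↥(rectangle (4 * n) n)⦄, (openGraph (ω ∩ ↑U)).Adj a b →
      b.1 0 ≤ a.1 0 + 1 :=
    fun a b hab ↦ hlipω (openGraph_mono Set.inter_subset_left hab)
  rw [← hx] at hreach'
  obtain ⟨z', hz', hzz'⟩ := exists_reachable_restrictConfig_of_reachable_below
    (finsetInclEmb (rectangle_half_subset n)) (fun a ↦ a.1 0) (2 * n)
    (exists_finsetIncl_eq_iff n) hlip' hreach'
  rw [mem_halfConn_iff]
  refine ⟨z', ?_, hzz'⟩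
  rw [mem_halfWiredSide, ← hz, ← hz']
  rfl

/-- **Last visit to the middle column: the right part of the path uses only outside edges.** For
a lattice configuration `ω` of the rectangle and an open path from `x` (`x₀ ≤ 2n`) to `u`
(`u₀ ≥ 2n`), `u` is joined to the middle column by open edges off the left half. [folklore] -/
theorem mem_rightConn_of_reachable {ω : BondConfig ↥(rectangle (4 * n) n)}
    (hω : ω ⊆ (finsetGraph (zdGraph 2) (rectangle (4 * n) n)).edgeSet)
    {x u : ↥(rectangle (4 * n) n)} (hx : x.1 0 ≤ 2 * n) (hu : (2 * n : ℤ) ≤ u.1 0)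
    (h : (openGraph ω).Reachable x u) : ω ∈ rightConn n u := by
  have hlipω : ∀ ⦃a b : ↥(rectangle (4 * n) n)⦄, (openGraph ω).Adj a b → -b.1 0 ≤ -a.1 0 + 1 :=
    fun a b hab ↦ by
      have := (apply_zero_le_add_one_of_adj ((finsetGraph_adj_iff a b).1
        ((mem_edgeSet (G := finsetGraph (zdGraph 2) (rectangle (4 * n) n))).1
        (hω ((openGraph_adj ω a b).1 hab).1)))).2
      omega
  obtain ⟨p⟩ := h.symm
  obtain ⟨z, hz, hreach⟩ := exists_level_reachable (fun a : ↥(rectangle (4 * n) n) ↦ -a.1 0)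
    (-(2 * n)) hlipω p (by omega) (by omega)
  refine ⟨z, by omega, hreach.mono ?_⟩
  intro a b hab
  rw [inf_adj, fromRel_adj, openGraph_adj] at hab
  obtain ⟨⟨hmem, hne⟩, -, hlt⟩ := hab
  rw [fromEdgeSet_adj]
  refine ⟨⟨hmem, ?_⟩, hne⟩
  rw [Finset.mem_coe, outsideEdges, Finset.mem_sdiff, mem_edgeFinset]
  refine ⟨hω hmem, fun hin ↦ ?_⟩
  have hends := apply_zero_le_of_mem_insideEdges n hin
  have ha := hends a (Sym2.mem_mk_left a b)
  have hb := hends b (Sym2.mem_mk_right a b)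
  rcases hlt with hlt | hlt <;> omega

/-- **The right part pulls back to the mirrored half.** If `u = j_R(u')` is joined to the middle
column by open edges off the left half, then the restriction to the half, along the mirrored
embedding, of `ω ∩ (right-half edges)` joins `u'` to the wired side. [folklore] -/
theorem restrictConfig_inter_mem_halfConn_of_mem_rightConn {ω : BondConfig ↥(rectangle (4 * n) n)}
    {u : ↥(rectangle (4 * n) n)} {u' : ↥(rectangle (2 * n) n)} (hu : rswMirrorEmb n u' = u)
    (h : ω ∈ rightConn n u) :
    restrictConfig (rswMirrorEmb n) (ω ∩ ↑(rightHalfEdges n)) ∈ halfConn n u' := by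
  obtain ⟨z, hz, hreach⟩ := h
  obtain ⟨z', hz'⟩ := (exists_rswMirrorEmb_eq_iff n z).2 (by omega)
  have heq : ω ∩ ↑(outsideEdges (zdGraph 2) (rectangle_half_subset n)) =
      (ω ∩ ↑(rightHalfEdges n)) ∩ ↑(outsideEdges (zdGraph 2) (rectangle_half_subset n)) := by
    rw [Set.inter_assoc, Set.inter_eq_right.2
      (Finset.coe_subset.2 (outsideEdges_subset_rightHalfEdges n))]
  rw [heq, ← hu, ← hz'] at hreach
  have hF : ∀ e ∈ (↑(outsideEdges (zdGraph 2) (rectangle_half_subset n)) :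
      Set (Sym2 ↥(rectangle (4 * n) n))), ∀ v ∈ e, ∃ a, rswMirrorEmb n a = v := by
    intro e he v hv
    rw [exists_rswMirrorEmb_eq_iff]
    exact mem_setOf_le_of_mem_sdiff_insideEdges n e (Finset.mem_coe.1 he) v hv
  have key := reachable_restrictConfig_of_reachable_inter (rswMirrorEmb n) hF hreach
  rw [mem_halfConn_iff]
  refine ⟨z', ?_, key⟩
  rw [mem_halfWiredSide]
  have := congrArg (fun w : ↥(rectangle (4 * n) n) ↦ w.1 0) hz'
  simp only [rswMirrorEmb_coe, rswMirror_apply_zero] at this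
  omega

end Events

/-! ### DCHN's comparison: two connected pairs cost two half-box connections to the wired side -/

section TwoPairs

variable {n : ℕ}

/-- **The two-pair comparison of Duminil-Copin–Hongler–Nolin** (2011, proof of Thm. 1, Step 1,
the display "`P⁰_{R_n^β}(x ↔ u, y ↔ v) ≤ P_{R_m^{2β},a_m,b_m}(x, y ↔ wired arc) ·
P_{R_m^{2β},a_m,b_m}(ū, v̄ ↔ wired arc)`", obtained from "the Domain Markov property … FKG … and
the symmetry of the lattice"), in H21's geometry: for the critical FK-Ising model with free
boundary conditions on `R = [0, 4n] × [0, n]`, sites `x = j_L(x')`, `y = j_L(y')` of the left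
half and `u = j_R(u')`, `v = j_R(v')` of the right half (`j_L` the inclusion of the half
`H = [0, 2n] × [0, n]`, `j_R` its reflection onto the right half),
`φ⁰_R(x ↔ u, y ↔ v) ≤ φ^{side}_H(x' ↔ side, y' ↔ side) · φ^{side}_H(u' ↔ side, v' ↔ side)`,
where `φ^{side}_H` is the measure of the half wired on its side `{x₀ = 2n}`. Proof: an open path
from `x` to `u` reaches the middle column a first time inside the left half and leaves it a last
time through edges off the left half (`restrictConfig_inter_mem_halfConn`,
`mem_rightConn_of_reachable`); condition on the configuration off the left half
(`real_inter_le_halfWired_mul` with `j_L`), then bound the remaining event of the right part by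
conditioning on the configuration off the right half (`real_inter_le_halfWired_mul` with `j_R`).
[cite: DuminilCopinHonglerNolin2011, §4, proof of Thm. 1, Step 1] -/
theorem real_openConnIn_inter_openConnIn_le_mul {x y u v : ↥(rectangle (4 * n) n)}
    {x' y' u' v' : ↥(rectangle (2 * n) n)}
    (hx : finsetIncl (rectangle_half_subset n) x' = x)
    (hy : finsetIncl (rectangle_half_subset n) y' = y)
    (hu : rswMirrorEmb n u' = u) (hv : rswMirrorEmb n v' = v) :
    (rcMeasure (finsetGraph (zdGraph 2) (rectangle (4 * n) n)) criticalFKIsingParam 2 ∅).real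
        (openConnIn Set.univ x u ∩ openConnIn Set.univ y v) ≤
      (rcMeasure (finsetGraph (zdGraph 2) (rectangle (2 * n) n)) criticalFKIsingParam 2
          (halfWiredSide n)).real (halfConn n x' ∩ halfConn n y') *
        (rcMeasure (finsetGraph (zdGraph 2) (rectangle (2 * n) n)) criticalFKIsingParam 2
          (halfWiredSide n)).real (halfConn n u' ∩ halfConn n v') := by
  have hp : criticalFKIsingParam ∈ Set.Icc (0 : ℝ) 1 := criticalFKIsingParam_mem_Icc
  set GR := finsetGraph (zdGraph 2) (rectangle (4 * n) n) with hGR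
  set GH := finsetGraph (zdGraph 2) (rectangle (2 * n) n) with hGH
  set UL : Finset (Sym2 ↥(rectangle (4 * n) n)) := insideEdges (zdGraph 2) (rectangle_half_subset n)
    with hUL
  set UR : Finset (Sym2 ↥(rectangle (4 * n) n)) := rightHalfEdges n with hUR
  haveI : IsProbabilityMeasure (rcMeasure GR criticalFKIsingParam 2 ∅) :=
    isProbabilityMeasure_rcMeasure GR hp two_pos ∅
  have hu0 : (2 * n : ℤ) ≤ u.1 0 := (exists_rswMirrorEmb_eq_iff n u).1 ⟨u', hu⟩
  have hv0 : (2 * n : ℤ) ≤ v.1 0 := (exists_rswMirrorEmb_eq_iff n v).1 ⟨v', hv⟩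
  have hx0 : x.1 0 ≤ 2 * n := (exists_finsetIncl_eq_iff n x).1 ⟨x', hx⟩
  have hy0 : y.1 0 ≤ 2 * n := (exists_finsetIncl_eq_iff n y).1 ⟨y', hy⟩
  -- the events after the decomposition of the paths at the middle column
  set XL : Set (BondConfig ↥(rectangle (4 * n) n)) :=
    {ω | restrictConfig (finsetInclEmb (rectangle_half_subset n)) (ω ∩ ↑UL) ∈
      halfConn n x' ∩ halfConn n y'} with hXL
  set D : Set (BondConfig ↥(rectangle (4 * n) n)) := rightConn n u ∩ rightConn n v with hD
  set XR : Set (BondConfig ↥(rectangle (4 * n) n)) :=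
    {ω | restrictConfig (rswMirrorEmb n) (ω ∩ ↑UR) ∈ halfConn n u' ∩ halfConn n v'} with hXR
  -- Step 0: on lattice configurations, `{x ↔ u} ∩ {y ↔ v} ⊆ XL ∩ D`
  have h0 : (rcMeasure GR criticalFKIsingParam 2 ∅).real
        (openConnIn Set.univ x u ∩ openConnIn Set.univ y v) ≤
      (rcMeasure GR criticalFKIsingParam 2 ∅).real (XL ∩ D) := by
    refine rcMeasure_real_mono_on_edgeSets GR hp two_pos ∅ fun ω hω hmem ↦ ?_
    rw [Set.mem_inter_iff, mem_openConnIn_univ_iff, mem_openConnIn_univ_iff] at hmem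
    exact ⟨⟨restrictConfig_inter_mem_halfConn hω hx hu0 hmem.1,
      restrictConfig_inter_mem_halfConn hω hy hv0 hmem.2⟩,
      mem_rightConn_of_reachable hω hx0 hu0 hmem.1, mem_rightConn_of_reachable hω hy0 hv0 hmem.2⟩
  -- Step 1: condition on the configuration off the left half
  have h1 : (rcMeasure GR criticalFKIsingParam 2 ∅).real (XL ∩ D) ≤
      (rcMeasure GH criticalFKIsingParam 2 (halfWiredSide n)).real (halfConn n x' ∩ halfConn n y') *
        (rcMeasure GR criticalFKIsingParam 2 ∅).real D :=
    real_inter_le_halfWired_mul (finsetInclEmb (rectangle_half_subset n)) rfl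
      (insideEdges_subset_edgeFinset (rectangle_half_subset n)) (mem_setOf_le_iff_finsetIncl n)
      (mem_setOf_le_of_mem_sdiff_insideEdges n)
      ((isUpperSet_halfConn n x').inter (isUpperSet_halfConn n y'))
      (fun ω₁ ω₂ h ↦ and_congr (rightConn_determined n u ω₁ ω₂ h)
        (rightConn_determined n v ω₁ ω₂ h))
  -- Step 2: the right part is an increasing event of the mirrored half
  have h2 : (rcMeasure GR criticalFKIsingParam 2 ∅).real D ≤
      (rcMeasure GR criticalFKIsingParam 2 ∅).real (XR ∩ Set.univ) := by
    rw [Set.inter_univ]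
    refine rcMeasure_real_mono_on_edgeSets GR hp two_pos ∅ fun ω _ hmem ↦ ?_
    exact ⟨restrictConfig_inter_mem_halfConn_of_mem_rightConn hu hmem.1,
      restrictConfig_inter_mem_halfConn_of_mem_rightConn hv hmem.2⟩
  -- Step 3: condition on the configuration off the right half
  have h3 : (rcMeasure GR criticalFKIsingParam 2 ∅).real (XR ∩ Set.univ) ≤
      (rcMeasure GH criticalFKIsingParam 2 (halfWiredSide n)).real (halfConn n u' ∩ halfConn n v') *
        (rcMeasure GR criticalFKIsingParam 2 ∅).real Set.univ :=
    real_inter_le_halfWired_mul (rswMirrorEmb n) rfl (rightHalfEdges_subset_edgeFinset n)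
      (mem_setOf_ge_iff_rswMirrorEmb n) (mem_setOf_ge_of_mem_sdiff_rightHalfEdges n)
      ((isUpperSet_halfConn n u').inter (isUpperSet_halfConn n v')) (fun _ _ _ ↦ Iff.rfl)
  rw [probReal_univ, mul_one] at h3
  calc (rcMeasure GR criticalFKIsingParam 2 ∅).real (openConnIn Set.univ x u ∩ openConnIn Set.univ y v)
      ≤ (rcMeasure GR criticalFKIsingParam 2 ∅).real (XL ∩ D) := h0
    _ ≤ (rcMeasure GH criticalFKIsingParam 2 (halfWiredSide n)).real (halfConn n x' ∩ halfConn n y') *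
          (rcMeasure GR criticalFKIsingParam 2 ∅).real D := h1
    _ ≤ (rcMeasure GH criticalFKIsingParam 2 (halfWiredSide n)).real (halfConn n x' ∩ halfConn n y') *
          (rcMeasure GH criticalFKIsingParam 2 (halfWiredSide n)).real
            (halfConn n u' ∩ halfConn n v') :=
        mul_le_mul_of_nonneg_left (h2.trans h3) measureReal_nonneg

end TwoPairs

/-! ## The assembly: `fkIsing_rsw` from DCHN's Propositions 13 and 14

The remaining, elementary steps of DCHN 2011, proof of Thm. 1, Step 1: the arithmetic of the
second moment ("Summing the bound provided by Proposition 14 on all sites `x, y ∈ ∂₋R` and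
`u, v ∈ ∂₊R`, we obtain `E⁰[N_n²] ≤ c₇ n²`"), the first moment ("Proposition 13 directly provides
the following lower bound on the expectation by summing on the `(βn)²` pairs of points `(x, u)`
far enough from the corners … `E⁰[N_n] ≥ c₆(β) n`"), and the final appeal to the
second-moment reduction `fkIsing_rsw_of_pairCount_moments` of `FKIsingRSWProofs.lean`. -/

section Arithmetic

/-- `1/√(k+1) ≤ 2(√(k+1) - √k)`. [folklore] -/
theorem one_div_sqrt_succ_le (k : ℕ) :
    1 / Real.sqrt ((k : ℝ) + 1) ≤ 2 * (Real.sqrt ((k : ℝ) + 1) - Real.sqrt k) := by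
  have hk : (0 : ℝ) ≤ k := Nat.cast_nonneg k
  have hb : 0 < Real.sqrt ((k : ℝ) + 1) := Real.sqrt_pos.2 (by linarith)
  have hab : Real.sqrt (k : ℝ) ≤ Real.sqrt ((k : ℝ) + 1) := Real.sqrt_le_sqrt (by linarith)
  have hsq : Real.sqrt ((k : ℝ) + 1) ^ 2 - Real.sqrt (k : ℝ) ^ 2 = 1 := by
    rw [Real.sq_sqrt (by linarith), Real.sq_sqrt hk]; ring
  rw [div_le_iff₀ hb]
  nlinarith [Real.sqrt_nonneg (k : ℝ)]

/-- `∑_{k ≤ m} 1/√(k+1) ≤ 2 √(m+1)` (telescoping). [folklore] -/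
theorem sum_range_one_div_sqrt_le (m : ℕ) :
    ∑ k ∈ Finset.range (m + 1), 1 / Real.sqrt ((k : ℝ) + 1) ≤ 2 * Real.sqrt ((m : ℝ) + 1) := by
  calc ∑ k ∈ Finset.range (m + 1), 1 / Real.sqrt ((k : ℝ) + 1)
      ≤ ∑ k ∈ Finset.range (m + 1), 2 * (Real.sqrt ((k : ℝ) + 1) - Real.sqrt k) :=
        Finset.sum_le_sum fun k _ ↦ one_div_sqrt_succ_le k
    _ = 2 * Real.sqrt ((m : ℝ) + 1) := by
        rw [← Finset.mul_sum]
        have h := Finset.sum_range_sub (fun k : ℕ ↦ Real.sqrt (k : ℝ)) (m + 1)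
        simp only [Nat.cast_add, Nat.cast_one, Nat.cast_zero, Real.sqrt_zero, sub_zero] at h
        rw [h]

/-- For `i ≤ n`: `∑_{j ≤ n} 1/√(|i - j| + 1) ≤ 4 √(n+1)`. [folklore] -/
theorem sum_range_one_div_sqrt_abs_le {n i : ℕ} (hi : i ≤ n) :
    ∑ j ∈ Finset.range (n + 1), 1 / Real.sqrt (|(i : ℝ) - j| + 1) ≤ 4 * Real.sqrt ((n : ℝ) + 1) := by
  have hF0 : ∀ k : ℕ, 0 ≤ 1 / Real.sqrt ((k : ℝ) + 1) := fun k ↦ by positivity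
  -- split at `i`
  rw [← Finset.sum_filter_add_sum_filter_not (Finset.range (n + 1)) (fun j ↦ j ≤ i)]
  have h1 : ∑ j ∈ (Finset.range (n + 1)).filter (fun j ↦ j ≤ i),
      1 / Real.sqrt (|(i : ℝ) - j| + 1) ≤ 2 * Real.sqrt ((n : ℝ) + 1) := by
    have hinj : Set.InjOn (fun j : ℕ ↦ i - j) ↑((Finset.range (n + 1)).filter (fun j ↦ j ≤ i)) := by
      intro a ha b hb hab
      simp only [Finset.coe_filter, Finset.mem_range, Set.mem_setOf_eq] at ha hb
      simp only at hab
      omega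
    have heq : ∀ j ∈ (Finset.range (n + 1)).filter (fun j ↦ j ≤ i),
        1 / Real.sqrt (|(i : ℝ) - j| + 1) = 1 / Real.sqrt (((i - j : ℕ) : ℝ) + 1) := by
      intro j hj
      simp only [Finset.mem_filter, Finset.mem_range] at hj
      rw [Nat.cast_sub hj.2, abs_of_nonneg (by simpa using (Nat.cast_le (α := ℝ)).2 hj.2)]
    rw [Finset.sum_congr rfl heq, ← Finset.sum_image (g := fun j : ℕ ↦ i - j)
      (f := fun k : ℕ ↦ 1 / Real.sqrt ((k : ℝ) + 1)) hinj]
    refine (Finset.sum_le_sum_of_subset_of_nonneg ?_ fun k _ _ ↦ hF0 k).trans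
      (sum_range_one_div_sqrt_le n)
    intro k hk
    simp only [Finset.mem_image, Finset.mem_filter, Finset.mem_range] at hk ⊢
    obtain ⟨j, ⟨hj1, hj2⟩, rfl⟩ := hk
    omega
  have h2 : ∑ j ∈ (Finset.range (n + 1)).filter (fun j ↦ ¬ j ≤ i),
      1 / Real.sqrt (|(i : ℝ) - j| + 1) ≤ 2 * Real.sqrt ((n : ℝ) + 1) := by
    have hinj : Set.InjOn (fun j : ℕ ↦ j - i) ↑((Finset.range (n + 1)).filter (fun j ↦ ¬ j ≤ i)) := by
      intro a ha b hb hab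
      simp only [Finset.coe_filter, Finset.mem_range, Set.mem_setOf_eq] at ha hb
      simp only at hab
      omega
    have heq : ∀ j ∈ (Finset.range (n + 1)).filter (fun j ↦ ¬ j ≤ i),
        1 / Real.sqrt (|(i : ℝ) - j| + 1) = 1 / Real.sqrt (((j - i : ℕ) : ℝ) + 1) := by
      intro j hj
      simp only [Finset.mem_filter, Finset.mem_range, not_le] at hj
      rw [Nat.cast_sub hj.2.le, abs_of_nonpos (by
        have := (Nat.cast_le (α := ℝ)).2 hj.2.le; linarith), neg_sub]
    rw [Finset.sum_congr rfl heq, ← Finset.sum_image (g := fun j : ℕ ↦ j - i)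
      (f := fun k : ℕ ↦ 1 / Real.sqrt ((k : ℝ) + 1)) hinj]
    refine (Finset.sum_le_sum_of_subset_of_nonneg ?_ fun k _ _ ↦ hF0 k).trans
      (sum_range_one_div_sqrt_le n)
    intro k hk
    simp only [Finset.mem_image, Finset.mem_filter, Finset.mem_range] at hk ⊢
    obtain ⟨j, ⟨hj1, hj2⟩, rfl⟩ := hk
    omega
  linarith

/-- The double sum: for `n ≥ 1`, `∑_{i,j ≤ n} 1/√((|i-j|+1) n) ≤ 12 n`. [folklore] -/
theorem sum_sum_one_div_sqrt_le {n : ℕ} (hn : 1 ≤ n) :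
    ∑ i ∈ Finset.range (n + 1), ∑ j ∈ Finset.range (n + 1),
        1 / Real.sqrt ((|(i : ℝ) - j| + 1) * n) ≤ 12 * n := by
  have hn0 : (0 : ℝ) < n := by exact_mod_cast hn
  have hsn : 0 < Real.sqrt n := Real.sqrt_pos.2 hn0
  have hterm : ∀ i j : ℕ, 1 / Real.sqrt ((|(i : ℝ) - j| + 1) * n) =
      (1 / Real.sqrt n) * (1 / Real.sqrt (|(i : ℝ) - j| + 1)) := by
    intro i j
    rw [Real.sqrt_mul (by positivity), one_div_mul_one_div, mul_comm]
  simp_rw [hterm, ← Finset.mul_sum]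
  have hinner : ∑ i ∈ Finset.range (n + 1), ∑ j ∈ Finset.range (n + 1),
      1 / Real.sqrt (|(i : ℝ) - j| + 1) ≤ (n + 1) * (4 * Real.sqrt ((n : ℝ) + 1)) := by
    calc ∑ i ∈ Finset.range (n + 1), ∑ j ∈ Finset.range (n + 1), 1 / Real.sqrt (|(i : ℝ) - j| + 1)
        ≤ ∑ i ∈ Finset.range (n + 1), 4 * Real.sqrt ((n : ℝ) + 1) :=
          Finset.sum_le_sum fun i hi ↦ sum_range_one_div_sqrt_abs_le
            (Nat.lt_succ_iff.1 (Finset.mem_range.1 hi))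
      _ = (n + 1) * (4 * Real.sqrt ((n : ℝ) + 1)) := by
          rw [Finset.sum_const, Finset.card_range, nsmul_eq_mul]; push_cast; ring
  -- `(n+1) √(n+1) ≤ 2n · (3/2) √n`
  have h1 : (n : ℝ) + 1 ≤ 2 * n := by linarith [show (1 : ℝ) ≤ n by exact_mod_cast hn]
  have hsqrt2 : Real.sqrt 2 ≤ 3 / 2 := by
    rw [show (3 / 2 : ℝ) = Real.sqrt ((3 / 2) ^ 2) by rw [Real.sqrt_sq (by norm_num)]]
    exact Real.sqrt_le_sqrt (by norm_num)
  have h2 : Real.sqrt ((n : ℝ) + 1) ≤ 3 / 2 * Real.sqrt n := by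
    calc Real.sqrt ((n : ℝ) + 1) ≤ Real.sqrt (2 * n) := Real.sqrt_le_sqrt h1
      _ = Real.sqrt 2 * Real.sqrt n := Real.sqrt_mul (by norm_num) _
      _ ≤ 3 / 2 * Real.sqrt n := mul_le_mul_of_nonneg_right hsqrt2 hsn.le
  calc 1 / Real.sqrt n * ∑ i ∈ Finset.range (n + 1), ∑ j ∈ Finset.range (n + 1),
        1 / Real.sqrt (|(i : ℝ) - j| + 1)
      ≤ 1 / Real.sqrt n * ((n + 1) * (4 * Real.sqrt ((n : ℝ) + 1))) :=
        mul_le_mul_of_nonneg_left hinner (by positivity)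
    _ ≤ 1 / Real.sqrt n * ((2 * n) * (4 * (3 / 2 * Real.sqrt n))) := by
        gcongr
    _ = 12 * n := by
        field_simp
        ring


end Arithmetic

/-! ### Sides of the rectangle, reindexing of sums over sides, windows -/

section Sides

variable (n : ℕ)

/-- The sites of the rectangle on the column `{x₀ = a}`. [folklore] -/
def columnSites (a : ℤ) : Finset ↥(↑(rectangle (4 * n) n) : Set (Site 2)) :=
  Finset.univ.filter fun x ↦ x.1 0 = a

/-- Membership in `columnSites`. [folklore] -/
@[simp] theorem mem_columnSites {a : ℤ} {x : ↥(↑(rectangle (4 * n) n) : Set (Site 2))} :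
    x ∈ columnSites n a ↔ x.1 0 = a := by
  simp [columnSites]

/-- The index set of `N_n` is (left side) × (right side). [folklore] -/
theorem rswPairs_eq_product :
    rswPairs n = columnSites n 0 ×ˢ columnSites n ((4 * n : ℕ) : ℤ) := by
  ext xy
  simp only [mem_rswPairs, Finset.mem_product, mem_columnSites]

/-- The site `(a, i)` of the rectangle. [folklore] -/
theorem vecCons_mem_rectangle {a : ℤ} (ha : 0 ≤ a ∧ a ≤ 4 * n) {i : ℕ} (hi : i ≤ n) :
    (![a, (i : ℤ)] : Site 2) ∈ (↑(rectangle (4 * n) n) : Set (Site 2)) := by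
  rw [Finset.mem_coe, mem_rectangle_iff]
  simp only [Matrix.cons_val_zero, Matrix.cons_val_one]
  push_cast
  omega

/-- **Reindexing a sum over a column by the second coordinate**: for `0 ≤ a ≤ 4n`,
`∑_{x : x₀ = a} F(x₁) = ∑_{i = 0}^{n} F(i)`. [folklore] -/
theorem sum_columnSites_eq_sum_range {a : ℤ} (ha : 0 ≤ a ∧ a ≤ 4 * n) (F : ℤ → ℝ) :
    ∑ x ∈ columnSites n a, F (x.1 1) = ∑ i ∈ Finset.range (n + 1), F i := by
  refine Finset.sum_bij' (fun x _ ↦ (x.1 1).toNat)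
    (fun i hi ↦ ⟨![a, (i : ℤ)], vecCons_mem_rectangle n ha
      (Nat.lt_succ_iff.1 (Finset.mem_range.1 hi))⟩) ?_ ?_ ?_ ?_ ?_
  · intro x _
    have hx := mem_rectangle_iff.1 (Finset.mem_coe.1 x.2)
    rw [Finset.mem_range, Nat.lt_succ_iff, Int.toNat_le]
    exact hx.2.2.2
  · intro i _
    rw [mem_columnSites]
    rfl
  · intro x hx
    rw [mem_columnSites] at hx
    have hx1 := (mem_rectangle_iff.1 (Finset.mem_coe.1 x.2)).2.2.1
    refine Subtype.ext ?_
    ext k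
    fin_cases k
    · simp [hx]
    · simp [Int.toNat_of_nonneg hx1]
  · intro i _
    simp
  · intro x _
    have hx1 := (mem_rectangle_iff.1 (Finset.mem_coe.1 x.2)).2.2.1
    simp [Int.toNat_of_nonneg hx1]

/-- The middle-half window of the column `{x₀ = a}`: sites with `n/4 ≤ x₁ ≤ 3n/4` ("far enough
from the corners", DCHN 2011, Prop. 13: `|x₁|, |u₁| ≤ βn/2`). [cite: DuminilCopinHonglerNolin2011, §4, Prop. 13] -/
def windowSites (a : ℤ) : Finset ↥(↑(rectangle (4 * n) n) : Set (Site 2)) :=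
  (columnSites n a).filter fun x ↦ (n : ℤ) ≤ 4 * x.1 1 ∧ 4 * x.1 1 ≤ 3 * n

/-- Membership in the window. [folklore] -/
@[simp] theorem mem_windowSites {a : ℤ} {x : ↥(↑(rectangle (4 * n) n) : Set (Site 2))} :
    x ∈ windowSites n a ↔ x.1 0 = a ∧ (n : ℤ) ≤ 4 * x.1 1 ∧ 4 * x.1 1 ≤ 3 * n := by
  rw [windowSites, Finset.mem_filter, mem_columnSites]

/-- **The window contains at least `n/4` sites** for `n ≥ 2` (it contains the sites `(a, i)`,
`⌈n/4⌉ ≤ i ≤ ⌊3n/4⌋`). [folklore] -/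
theorem le_four_mul_card_windowSites {a : ℤ} (ha : 0 ≤ a ∧ a ≤ 4 * n) (hn : 2 ≤ n) :
    n ≤ 4 * (windowSites n a).card := by
  classical
  -- the injection `i ↦ (a, i)` from `[⌈n/4⌉, ⌊3n/4⌋]`
  set f : ℕ → ↥(↑(rectangle (4 * n) n) : Set (Site 2)) := fun i ↦
    if hi : i ≤ n then ⟨![a, (i : ℤ)], vecCons_mem_rectangle n ha hi⟩
    else ⟨![a, 0], vecCons_mem_rectangle n ha (Nat.zero_le n)⟩ with hf
  have hcard : (Finset.Icc ((n + 3) / 4) (3 * n / 4)).card ≤ (windowSites n a).card := by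
    refine Finset.card_le_card_of_injOn f (fun i hi ↦ ?_) ?_
    · rw [Finset.mem_coe, Finset.mem_Icc] at hi
      have hin : i ≤ n := by omega
      simp only [hf, dif_pos hin, Finset.mem_coe, mem_windowSites, Matrix.cons_val_zero,
        Matrix.cons_val_one, true_and]
      constructor <;> omega
    · intro i hi j hj hij
      rw [Finset.mem_coe, Finset.mem_Icc] at hi hj
      have hin : i ≤ n := by omega
      have hjn : j ≤ n := by omega
      simp only [hf, dif_pos hin, dif_pos hjn, Subtype.mk.injEq] at hij
      have := congr_fun hij 1
      simp only [Matrix.cons_val_one, Matrix.cons_val_fin_one] at this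
      exact_mod_cast this
  rw [Nat.card_Icc] at hcard
  omega

end Sides

/-! ### Positivity: the expected number of connected pairs is positive -/

section Positivity

variable (n : ℕ)

/-- The bottom row of the rectangle is connected in the rectangle graph: `(0,0) ↔ (k,0)`.
[folklore] -/
theorem reachable_bottomRow (k : ℕ) (hk : k ≤ 4 * n) :
    (finsetGraph (zdGraph 2) (rectangle (4 * n) n)).Reachable
      ⟨![0, ((0 : ℕ) : ℤ)], vecCons_mem_rectangle n ⟨le_rfl, by positivity⟩ (Nat.zero_le n)⟩
      ⟨![(k : ℤ), ((0 : ℕ) : ℤ)], vecCons_mem_rectangle n ⟨by positivity, by exact_mod_cast hk⟩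
        (Nat.zero_le n)⟩ := by
  induction k with
  | zero => exact Reachable.refl _
  | succ k ih =>
    refine (ih (by omega)).trans (Adj.reachable ?_)
    rw [finsetGraph_adj_iff, zdGraph_adj_iff]
    refine ⟨0, Or.inl ?_⟩
    ext j
    fin_cases j
    · simp
    · simp

/-- The weights of the critical FK-Ising model are strictly positive. [folklore] -/
theorem rcWeight_criticalFKIsingParam_pos {V : Type*} [Fintype V] [DecidableEq V]
    (G : SimpleGraph V) [DecidableRel G.Adj] (B : Set V) (ω : Finset (Sym2 V)) :
    0 < rcWeight G criticalFKIsingParam 2 B ω := by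
  have h := criticalFKIsingParam_mem_Ioo
  unfold rcWeight
  have h1 : 0 < 1 - criticalFKIsingParam := by linarith [h.2]
  have h0 := h.1
  positivity

/-- The bottom-left corner `(0, 0)` of the rectangle. [folklore] -/
def cornerLeft : ↥(↑(rectangle (4 * n) n) : Set (Site 2)) :=
  ⟨![0, ((0 : ℕ) : ℤ)], vecCons_mem_rectangle n ⟨le_rfl, by positivity⟩ (Nat.zero_le n)⟩

/-- The bottom-right corner `(4n, 0)` of the rectangle. [folklore] -/
def cornerRight : ↥(↑(rectangle (4 * n) n) : Set (Site 2)) :=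
  ⟨![((4 * n : ℕ) : ℤ), ((0 : ℕ) : ℤ)], vecCons_mem_rectangle n
    ⟨by positivity, by push_cast; exact le_rfl⟩ (Nat.zero_le n)⟩

/-- The bottom-left corner is on the left side. [folklore] -/
@[simp] theorem cornerLeft_apply_zero : (cornerLeft n).1 0 = 0 := rfl

/-- The bottom-right corner is on the right side. [folklore] -/
@[simp] theorem cornerRight_apply_zero : (cornerRight n).1 0 = ((4 * n : ℕ) : ℤ) := rfl

/-- **The corner-to-corner connection along the bottom row has positive probability** under the
free critical FK-Ising measure of the rectangle (the all-open configuration has positive weight).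
[folklore] -/
theorem real_openConnIn_corners_pos :
    0 < (fkIsingFiniteMeasure (rectangle (4 * n) n) ∅).real
      (openConnIn Set.univ (cornerLeft n) (cornerRight n)) := by
  classical
  have hp : criticalFKIsingParam ∈ Set.Icc (0 : ℝ) 1 := criticalFKIsingParam_mem_Icc
  rw [fkIsingFiniteMeasure_eq_finsetGraph]
  set G := finsetGraph (zdGraph 2) (rectangle (4 * n) n) with hG
  have hZ := rcPartitionFunction_pos G hp two_pos ∅
  rw [rcMeasure_real_apply G hp two_pos ∅]
  refine lt_of_lt_of_le ?_ (Finset.single_le_sum (fun ω _ ↦ ?_) (Finset.mem_powerset_self _))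
  · rw [if_pos]
    · exact div_pos (rcWeight_criticalFKIsingParam_pos G ∅ _) hZ
    · rw [mem_openConnIn_univ_iff]
      have hGeq : openGraph (↑G.edgeFinset : BondConfig ↥(rectangle (4 * n) n)) = G := by
        rw [openGraph, coe_edgeFinset, fromEdgeSet_edgeSet]
      rw [hGeq]
      exact reachable_bottomRow n (4 * n) le_rfl
  · split_ifs
    · exact div_nonneg (rcWeight_nonneg G hp two_pos.le ∅ ω) hZ.le
    · exact le_rfl

end Positivity

/-! ### The final assembly -/

section Assembly

/-- The two-pair comparison for the measures `fkIsingFiniteMeasure` of `FKIsingRSW.lean`.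
[cite: DuminilCopinHonglerNolin2011, §4, proof of Thm. 1, Step 1] -/
theorem fkIsingFiniteMeasure_real_openConnIn_inter_le_mul {n : ℕ}
    {x y u v : ↥(↑(rectangle (4 * n) n) : Set (Site 2))} {x' y' u' v' : ↥(rectangle (2 * n) n)}
    (hx : finsetIncl (rectangle_half_subset n) x' = x)
    (hy : finsetIncl (rectangle_half_subset n) y' = y)
    (hu : rswMirrorEmb n u' = u) (hv : rswMirrorEmb n v' = v) :
    (fkIsingFiniteMeasure (rectangle (4 * n) n) ∅).real
        (openConnIn Set.univ x u ∩ openConnIn Set.univ y v) ≤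
      (fkIsingFiniteMeasure (rectangle (2 * n) n) (halfWiredSide n)).real
          (halfConn n x' ∩ halfConn n y') *
        (fkIsingFiniteMeasure (rectangle (2 * n) n) (halfWiredSide n)).real
          (halfConn n u' ∩ halfConn n v') := by
  rw [fkIsingFiniteMeasure_eq_finsetGraph, fkIsingFiniteMeasure_eq_finsetGraph]
  exact real_openConnIn_inter_openConnIn_le_mul hx hy hu hv

/-- A left-side site of the rectangle as a site of the half. [folklore] -/
def toHalfLeft {n : ℕ} (x : ↥(↑(rectangle (4 * n) n) : Set (Site 2))) (hx : x.1 0 = 0) :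
    ↥(rectangle (2 * n) n) :=
  ⟨x.1, by
    obtain ⟨-, -, h1, h1'⟩ := mem_rectangle_iff.1 (Finset.mem_coe.1 x.2)
    rw [mem_rectangle_iff, hx]
    exact ⟨le_rfl, by positivity, h1, h1'⟩⟩

/-- A right-side site of the rectangle, reflected, as a site of the half. [folklore] -/
def toHalfRight {n : ℕ} (u : ↥(↑(rectangle (4 * n) n) : Set (Site 2)))
    (hu : u.1 0 = ((4 * n : ℕ) : ℤ)) : ↥(rectangle (2 * n) n) :=
  ⟨rswMirror n u.1, by
    obtain ⟨-, -, h1, h1'⟩ := mem_rectangle_iff.1 (Finset.mem_coe.1 u.2)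
    rw [mem_rectangle_iff]
    simp only [rswMirror_apply_zero, rswMirror_apply_one, hu]
    push_cast
    exact ⟨by omega, by omega, h1, h1'⟩⟩

/-- A product of two double sums over a product index set. [folklore] -/
theorem sum_product_sum_product_mul {α β : Type*} (s : Finset α) (t : Finset β)
    (a : α → α → ℝ) (b : β → β → ℝ) :
    ∑ p ∈ s ×ˢ t, ∑ q ∈ s ×ˢ t, a p.1 q.1 * b p.2 q.2 =
      (∑ x ∈ s, ∑ y ∈ s, a x y) * ∑ u ∈ t, ∑ v ∈ t, b u v := by
  rw [Finset.sum_product, Finset.sum_mul_sum]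
  refine Finset.sum_congr rfl fun x _ ↦ ?_
  refine Finset.sum_congr rfl fun u _ ↦ ?_
  rw [Finset.sum_product, Finset.sum_mul_sum]

/-- **RSW for the critical FK-Ising model from DCHN's Propositions 13 and 14** (Duminil-Copin–
Hongler–Nolin 2011, Thm. 1, free boundary conditions = Duminil-Copin–Smirnov 2012, Thm. 3.16;
DCHN §4, proof of Thm. 1, Step 1, all of whose steps are proved in the tree, here assembled).
The two hypotheses are the analytic inputs of that proof, in H21's geometry of `fkIsing_rsw`
(the `4n × n` rectangle `R = [0, 4n] × [0, n]`, left-to-right):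

* `h13` — **DCHN Prop. 13** (connection probability for one point, `β = 1/4`, transposed): there is
  `c > 0` such that for all `n ≥ 1` and all sites `x` of the left side and `u` of the right side
  of `R` whose second coordinates lie in the middle half `[n/4, 3n/4]` of the sides ("far enough
  from the corners"), `φ⁰_R(x ↔ u) ≥ c/n`;
* `h14` — **DCHN Prop. 14 with Lemma 15** (connection probability for two points, `β = 1/2`):
  there is `C` such that for all `n ≥ 1` and all sites `a, b` of the free side `{x₀ = 0}` of the
  half `H = [0, 2n] × [0, n]` with its far side `{x₀ = 2n}` wired,
  `φ^{side}_H(a ↔ side, b ↔ side) ≤ C / √((|a₁ - b₁| + 1) n)` (DCHN: `≤ c/√(|a - b| n)` for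
  `a ≠ b`, and `≤ c₅/√n` for `a = b` by Lemma 15 with `k = 1`).

Then `fkIsing_rsw` holds. Proof (DCHN p. 14): `E⁰[N_n²] = Σ φ⁰_R(x ↔ u, y ↔ v) ≤
(Σ_{x,y} φ^{side}_H(x', y' ↔ side)) (Σ_{u,v} φ^{side}_H(u', v' ↔ side)) ≤ (12 C n)²`
(`integral_rswPairCount_sq`, `fkIsingFiniteMeasure_real_openConnIn_inter_le_mul`, `h14`,
`sum_sum_one_div_sqrt_le`); `E⁰[N_n] = Σ φ⁰_R(x ↔ u) ≥ (n/4)² · c/n` for `n ≥ 2` (`h13` on the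
window, `le_four_mul_card_windowSites`) and `E⁰[N_1] > 0` (`real_openConnIn_corners_pos`); and
`fkIsing_rsw_of_pairCount_moments` (Cauchy–Schwarz). Nothing here assumes `fkIsing_rsw`; the two
hypotheses are not named facts.
[cite: DuminilCopinHonglerNolin2011, §4, Props. 13, 14, Lemma 15 and proof of Thm. 1, Step 1] -/
theorem fkIsing_rsw_of_connection_bounds
    (h13 : ∃ c : ℝ, 0 < c ∧ ∀ n : ℕ, 1 ≤ n →
      ∀ x u : ↥(↑(rectangle (4 * n) n) : Set (Site 2)),
        x.1 0 = 0 → u.1 0 = ((4 * n : ℕ) : ℤ) →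
        (n : ℤ) ≤ 4 * x.1 1 → 4 * x.1 1 ≤ 3 * n → (n : ℤ) ≤ 4 * u.1 1 → 4 * u.1 1 ≤ 3 * n →
        c / n ≤ (fkIsingFiniteMeasure (rectangle (4 * n) n) ∅).real (openConnIn Set.univ x u))
    (h14 : ∃ C : ℝ, ∀ n : ℕ, 1 ≤ n →
      ∀ a b : ↥(↑(rectangle (2 * n) n) : Set (Site 2)), a.1 0 = 0 → b.1 0 = 0 →
        (fkIsingFiniteMeasure (rectangle (2 * n) n) (halfWiredSide n)).real
            (halfConn n a ∩ halfConn n b) ≤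
          C / Real.sqrt ((|(a.1 1 : ℝ) - (b.1 1 : ℝ)| + 1) * n)) :
    fkIsing_rsw := by
  obtain ⟨c, hc, h13⟩ := h13
  obtain ⟨C, h14⟩ := h14
  -- `C ≥ 0` (test `h14` at the corner of the half of `R_1`)
  have hC0 : 0 ≤ C := by
    have h := h14 1 le_rfl (toHalfLeft (cornerLeft 1) rfl) (toHalfLeft (cornerLeft 1) rfl) rfl rfl
    simp only [sub_self, abs_zero, zero_add, Nat.cast_one, mul_one, Real.sqrt_one, div_one] at h
    exact measureReal_nonneg.trans h
  have hp₁ := real_openConnIn_corners_pos 1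
  set p₁ : ℝ := (fkIsingFiniteMeasure (rectangle (4 * 1) 1) ∅).real
    (openConnIn Set.univ (cornerLeft 1) (cornerRight 1)) with hp₁def
  refine fkIsing_rsw_of_pairCount_moments ⟨min (c / 16) p₁, lt_min (by positivity) hp₁, ?_⟩
    ⟨(12 * C) ^ 2, ?_⟩
  · -- the first moment
    intro n hn
    rw [integral_rswPairCount]
    have hnonneg : ∀ xy ∈ rswPairs n,
        0 ≤ (fkIsingFiniteMeasure (rectangle (4 * n) n) ∅).real (openConnIn Set.univ xy.1 xy.2) :=
      fun xy _ ↦ measureReal_nonneg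
    by_cases hn1 : n = 1
    · subst hn1
      have hmem : (cornerLeft 1, cornerRight 1) ∈ rswPairs 1 := by
        rw [mem_rswPairs]; exact ⟨rfl, rfl⟩
      have hle := Finset.single_le_sum hnonneg hmem
      calc min (c / 16) p₁ * ((1 : ℕ) : ℝ) = min (c / 16) p₁ := by simp
        _ ≤ p₁ := min_le_right _ _
        _ ≤ ∑ xy ∈ rswPairs 1,
              (fkIsingFiniteMeasure (rectangle (4 * 1) 1) ∅).real (openConnIn Set.univ xy.1 xy.2) :=
            hle
    · have hn2 : 2 ≤ n := by omega
      have hsub : windowSites n 0 ×ˢ windowSites n ((4 * n : ℕ) : ℤ) ⊆ rswPairs n := by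
        rw [rswPairs_eq_product]
        exact Finset.product_subset_product (Finset.filter_subset _ _) (Finset.filter_subset _ _)
      have hW0 := le_four_mul_card_windowSites n (a := 0) ⟨le_rfl, by positivity⟩ hn2
      have hW1 := le_four_mul_card_windowSites n (a := ((4 * n : ℕ) : ℤ))
        ⟨by positivity, by push_cast; exact le_rfl⟩ hn2
      have hn0 : (0 : ℝ) < n := by exact_mod_cast hn
      calc min (c / 16) p₁ * n ≤ c / 16 * n := mul_le_mul_of_nonneg_right (min_le_left _ _) hn0.le
        _ ≤ ((windowSites n 0).card * (windowSites n ((4 * n : ℕ) : ℤ)).card : ℕ) * (c / n) := by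
            have h0 : (n : ℝ) ≤ 4 * (windowSites n 0).card := by exact_mod_cast hW0
            have h1 : (n : ℝ) ≤ 4 * (windowSites n ((4 * n : ℕ) : ℤ)).card := by exact_mod_cast hW1
            have hcn : 0 ≤ c / n := by positivity
            calc c / 16 * n = ((n : ℝ) * n / 16) * (c / n) := by field_simp
              _ ≤ ((windowSites n 0).card * (windowSites n ((4 * n : ℕ) : ℤ)).card : ℕ) * (c / n) := by
                  refine mul_le_mul_of_nonneg_right ?_ hcn
                  rw [Nat.cast_mul]
                  have hprod := mul_le_mul h0 h1 hn0.le (by positivity)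
                  linarith [hprod]
        _ = ∑ xy ∈ windowSites n 0 ×ˢ windowSites n ((4 * n : ℕ) : ℤ), c / n := by
            rw [Finset.sum_const, Finset.card_product, nsmul_eq_mul]
        _ ≤ ∑ xy ∈ windowSites n 0 ×ˢ windowSites n ((4 * n : ℕ) : ℤ),
              (fkIsingFiniteMeasure (rectangle (4 * n) n) ∅).real (openConnIn Set.univ xy.1 xy.2) := by
            refine Finset.sum_le_sum fun xy hxy ↦ ?_
            rw [Finset.mem_product, mem_windowSites, mem_windowSites] at hxy
            exact h13 n hn xy.1 xy.2 hxy.1.1 hxy.2.1 hxy.1.2.1 hxy.1.2.2 hxy.2.2.1 hxy.2.2.2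
        _ ≤ ∑ xy ∈ rswPairs n,
              (fkIsingFiniteMeasure (rectangle (4 * n) n) ∅).real (openConnIn Set.univ xy.1 xy.2) :=
            Finset.sum_le_sum_of_subset_of_nonneg hsub fun xy hxy _ ↦ hnonneg xy hxy
  · -- the second moment
    intro n hn
    have hn0 : (0 : ℝ) < n := by exact_mod_cast hn
    rw [integral_rswPairCount_sq]
    -- the bound for one pair of pairs
    set g : ℤ → ℤ → ℝ := fun s t ↦ C / Real.sqrt ((|(s : ℝ) - (t : ℝ)| + 1) * n) with hg
    have hg0 : ∀ s t, 0 ≤ g s t := fun s t ↦ by simp only [hg]; positivity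
    have hpair : ∀ xy ∈ rswPairs n, ∀ xy' ∈ rswPairs n,
        (fkIsingFiniteMeasure (rectangle (4 * n) n) ∅).real
            (openConnIn Set.univ xy.1 xy.2 ∩ openConnIn Set.univ xy'.1 xy'.2) ≤
          g (xy.1.1 1) (xy'.1.1 1) * g (xy.2.1 1) (xy'.2.1 1) := by
      intro xy hxy xy' hxy'
      rw [mem_rswPairs] at hxy hxy'
      have key := fkIsingFiniteMeasure_real_openConnIn_inter_le_mul
        (x' := toHalfLeft xy.1 hxy.1) (y' := toHalfLeft xy'.1 hxy'.1)
        (u' := toHalfRight xy.2 hxy.2) (v' := toHalfRight xy'.2 hxy'.2)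
        (Subtype.ext rfl) (Subtype.ext rfl) (Subtype.ext (rswMirror_rswMirror n _))
        (Subtype.ext (rswMirror_rswMirror n _))
      refine key.trans (mul_le_mul ?_ ?_ measureReal_nonneg (hg0 _ _))
      · exact h14 n hn _ _ hxy.1 hxy'.1
      · exact h14 n hn (toHalfRight xy.2 hxy.2) (toHalfRight xy'.2 hxy'.2)
          (by simp [toHalfRight, hxy.2]) (by simp [toHalfRight, hxy'.2])
    -- sum it
    have hside : ∀ {a : ℤ}, 0 ≤ a ∧ a ≤ 4 * n →
        ∑ x ∈ columnSites n a, ∑ y ∈ columnSites n a, g (x.1 1) (y.1 1) ≤ 12 * C * n := by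
      intro a ha
      have h1 : ∀ x ∈ columnSites n a, ∑ y ∈ columnSites n a, g (x.1 1) (y.1 1) =
          ∑ j ∈ Finset.range (n + 1), g (x.1 1) j :=
        fun x _ ↦ sum_columnSites_eq_sum_range n ha (g (x.1 1))
      rw [Finset.sum_congr rfl h1,
        sum_columnSites_eq_sum_range n ha (fun s ↦ ∑ j ∈ Finset.range (n + 1), g s j)]
      simp only [hg, Int.cast_natCast]
      simp_rw [div_eq_mul_one_div C, ← Finset.mul_sum]
      calc C * ∑ i ∈ Finset.range (n + 1), ∑ j ∈ Finset.range (n + 1),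
            1 / Real.sqrt ((|(i : ℝ) - (j : ℝ)| + 1) * n)
          ≤ C * (12 * n) := mul_le_mul_of_nonneg_left (sum_sum_one_div_sqrt_le hn) hC0
        _ = 12 * C * n := by ring
    have step1 : (∑ xy ∈ rswPairs n, ∑ xy' ∈ rswPairs n,
        (fkIsingFiniteMeasure (rectangle (4 * n) n) ∅).real
          (openConnIn Set.univ xy.1 xy.2 ∩ openConnIn Set.univ xy'.1 xy'.2)) ≤
        ∑ xy ∈ rswPairs n, ∑ xy' ∈ rswPairs n,
          g (xy.1.1 1) (xy'.1.1 1) * g (xy.2.1 1) (xy'.2.1 1) :=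
      Finset.sum_le_sum fun xy hxy ↦ Finset.sum_le_sum fun xy' hxy' ↦ hpair xy hxy xy' hxy'
    have step2 : (∑ xy ∈ rswPairs n, ∑ xy' ∈ rswPairs n,
          g (xy.1.1 1) (xy'.1.1 1) * g (xy.2.1 1) (xy'.2.1 1)) =
        (∑ x ∈ columnSites n 0, ∑ y ∈ columnSites n 0, g (x.1 1) (y.1 1)) *
          ∑ u ∈ columnSites n ((4 * n : ℕ) : ℤ), ∑ v ∈ columnSites n ((4 * n : ℕ) : ℤ),
            g (u.1 1) (v.1 1) := by
      rw [rswPairs_eq_product]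
      exact sum_product_sum_product_mul (columnSites n 0) (columnSites n ((4 * n : ℕ) : ℤ))
        (fun x y ↦ g (x.1 1) (y.1 1)) (fun u v ↦ g (u.1 1) (v.1 1))
    have step3 : (∑ x ∈ columnSites n 0, ∑ y ∈ columnSites n 0, g (x.1 1) (y.1 1)) *
          ∑ u ∈ columnSites n ((4 * n : ℕ) : ℤ), ∑ v ∈ columnSites n ((4 * n : ℕ) : ℤ),
            g (u.1 1) (v.1 1) ≤ (12 * C * n) * (12 * C * n) :=
      mul_le_mul (hside ⟨le_rfl, by positivity⟩)
        (hside ⟨by positivity, by push_cast; exact le_rfl⟩)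
        (Finset.sum_nonneg fun u _ ↦ Finset.sum_nonneg fun v _ ↦ hg0 _ _)
        (mul_nonneg (mul_nonneg (by norm_num) hC0) hn0.le)
    calc (∑ xy ∈ rswPairs n, ∑ xy' ∈ rswPairs n,
        (fkIsingFiniteMeasure (rectangle (4 * n) n) ∅).real
          (openConnIn Set.univ xy.1 xy.2 ∩ openConnIn Set.univ xy'.1 xy'.2))
        ≤ (12 * C * n) * (12 * C * n) := step1.trans (step2.le.trans step3)
      _ = (12 * C) ^ 2 * (n : ℝ) ^ 2 := by ring

end Assembly

end Literature.Probability.LatticeModels
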